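import Mathlib.LinearAlgebra.BilinearForm.Properties
import Mathlib.LinearAlgebra.Span.Basic
import Mathlib.GroupTheory.Index
import Mathlib.Logic.Relation
import Mathlib.Tactic.Module
import Literature.AlgebraicGeometry.HodgeTheory.SkewVanishingLattice

/-!
# Route LinearSystemTorelli — crux `LocalTubeSpan`: orbits of finite-index subgroups of `Γ_Δ` span

Helper file (`--supports stmt-HodgeConjecture-2490`, line `Sketch`, cycle 6, stub `stub_orbitSpan`).
Cycle 6 of the line derives Schnell's Lemma 11 ([Schnell2010] §7) for DEGENERATE skew vanishing
lattices from the nondegenerate case; this stub is its first ingredient: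

* `localTubeSpan_orbitSpan` — for a skew vanishing lattice `Δ` of an alternating (possibly
  degenerate) form `B` on a `ℚ`-space `V` and a subgroup `H ≤ Γ_Δ = transvectionGroup B Δ` of
  FINITE INDEX, the `H`-orbit of any `δ₀ ∈ Δ` spans `V`.

Proof.  `W := ℚ⟨H · δ₀⟩` is `H`-stable.  For `δ ∈ Δ` some power `T_δ^m`, `m ≥ 1`, lies in `H`
(finite index), and `T_δ^m(w) = w - m B(w, δ) δ`, so `δ ∈ W` as soon as `B(w, δ) ≠ 0` for some
`w ∈ W` (characteristic `0`).  Hence `W` contains every `δ ∈ Δ` reachable from `δ₀` along the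
non-orthogonality graph of `Δ` (edges `B(δ, δ') ≠ 0`).  That graph is connected: the set of cycles
reachable from `δ₀` is stable under every generator `T_δ^{±1}` of `Γ_Δ`
(`T_δ^{±1} δ' = δ' ∓ B(δ', δ) δ` equals `δ'` if `B(δ', δ) = 0`, and otherwise is a cycle adjacent
to `δ`, itself adjacent to `δ'`), hence under `Γ_Δ`, which is transitive on `Δ`.  So `Δ ⊆ W`, and
`W = V` because `Δ` spans.

Reference: C. Schnell, *Primitive cohomology and the tube mapping*, Math. Z. 268 (2010)
(= arXiv:0711.3927) §7 (skew-symmetric vanishing lattices, Lemma 11).  Elementary; no named facts.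
-/

-- `Summit.HodgeConjecture.HodgeConjecture.Theorems` is the mandated namespace (single-conjunct summit:
-- Sub = Summit), which `linter.dupNamespace` flags on every declaration; the lakefile turns the
-- linter off tree-wide (weak option), restated here so stand-alone elaboration is warning-free too.
set_option linter.dupNamespace false

noncomputable section

open Literature.AlgebraicGeometry.HodgeTheory

namespace Summit.HodgeConjecture.HodgeConjecture.Theorems

/-! ### Powers and inverses of transvection units -/

section Units

variable {K V : Type*} [CommRing K] [AddCommGroup V] [Module K V] (B : LinearMap.BilinForm K V)

/-- The inverse of a unit of `End V` acting as the transvection `T_δ(x) = x - B(x, δ)δ` with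
`B(δ, δ) = 0` acts as `x ↦ x + B(x, δ)δ`. [folklore] -/
theorem localTubeSpan_unit_inv_apply {u : (V →ₗ[K] V)ˣ} {δ : V}
    (hu : (u : V →ₗ[K] V) = skewTransvection B δ) (hδδ : B δ δ = 0) (x : V) :
    ((u⁻¹ : (V →ₗ[K] V)ˣ) : V →ₗ[K] V) x = x + B x δ • δ := by
  have h1 : (u : V →ₗ[K] V) (x + B x δ • δ) = x := by
    rw [hu]
    exact skewTransvection_apply_add B hδδ x
  calc ((u⁻¹ : (V →ₗ[K] V)ˣ) : V →ₗ[K] V) x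
        = ((u⁻¹ : (V →ₗ[K] V)ˣ) : V →ₗ[K] V) ((u : V →ₗ[K] V) (x + B x δ • δ)) := by rw [h1]
    _ = x + B x δ • δ := by rw [← Module.End.mul_apply, Units.inv_mul, Module.End.one_apply]

/-- Powers of a transvection: `T_δ^n(x) = x - n B(x, δ) δ` when `B(δ, δ) = 0`. [folklore] -/
theorem localTubeSpan_unit_pow_apply {u : (V →ₗ[K] V)ˣ} {δ : V}
    (hu : (u : V →ₗ[K] V) = skewTransvection B δ) (hδδ : B δ δ = 0) (n : ℕ) (x : V) :
    ((u ^ n : (V →ₗ[K] V)ˣ) : V →ₗ[K] V) x = x - ((n : K) * B x δ) • δ := by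
  induction n with
  | zero => rw [pow_zero, Units.val_one, Module.End.one_apply, Nat.cast_zero, zero_mul, zero_smul,
      sub_zero]
  | succ n ih =>
      rw [pow_succ', Units.val_mul, Module.End.mul_apply, ih, hu, skewTransvection_apply]
      simp only [map_sub, map_smul, LinearMap.sub_apply, LinearMap.smul_apply, smul_eq_mul, hδδ,
        mul_zero, sub_zero, Nat.cast_succ]
      module

end Units

/-! ### The non-orthogonality graph of a vanishing lattice is connected -/

section Reach

variable {V : Type*} [AddCommGroup V] [Module ℚ V] (B : LinearMap.BilinForm ℚ V)

/-- A cycle reachable from `δ₀ ∈ Δ` along the non-orthogonality graph of `Δ` lies in `Δ`.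
[folklore] -/
theorem localTubeSpan_reach_mem {Δ : Set V} {δ₀ δ : V} (hδ₀ : δ₀ ∈ Δ)
    (h : Relation.ReflTransGen (fun a b => a ∈ Δ ∧ b ∈ Δ ∧ B a b ≠ 0) δ₀ δ) : δ ∈ Δ := by
  induction h with
  | refl => exact hδ₀
  | tail _ hbc _ => exact hbc.2.1

/-- One step of the connectivity argument: if `δ'` is reachable from `δ₀`, `δ, y ∈ Δ`,
`B(δ, y) = B(δ, δ')` and `y = δ'` unless `B(δ', δ) ≠ 0` (the shape of `y = T_δ^{±1} δ'`), then `y`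
is reachable from `δ₀` (through `δ' ∼ δ ∼ y` when `B(δ', δ) ≠ 0`). [folklore] -/
theorem localTubeSpan_reach_step (hB : B.IsAlt) {Δ : Set V} {δ₀ δ δ' y : V} (hδ₀ : δ₀ ∈ Δ)
    (hδ : δ ∈ Δ) (hδ' : Relation.ReflTransGen (fun a b => a ∈ Δ ∧ b ∈ Δ ∧ B a b ≠ 0) δ₀ δ')
    (hy : y ∈ Δ) (hBy : B δ y = B δ δ') (hfix : B δ' δ = 0 → y = δ') :
    Relation.ReflTransGen (fun a b => a ∈ Δ ∧ b ∈ Δ ∧ B a b ≠ 0) δ₀ y := by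
  by_cases h0 : B δ' δ = 0
  · rw [hfix h0]
    exact hδ'
  · refine (hδ'.tail ⟨localTubeSpan_reach_mem B hδ₀ hδ', hδ, h0⟩).tail ⟨hδ, hy, ?_⟩
    rw [hBy, ← hB.neg_eq δ' δ]
    exact neg_ne_zero.2 h0

/-- The set of cycles reachable from `δ₀ ∈ Δ` along the non-orthogonality graph of a skew vanishing
lattice `Δ` is stable under the monodromy group `Γ_Δ`. [cite: Schnell2010, §7 Lemma 11 (proof)] -/
theorem localTubeSpan_reach_stable (hB : B.IsAlt) {Δ : Set V} (hΔ : IsSkewVanishingLattice B Δ)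
    {δ₀ : V} (hδ₀ : δ₀ ∈ Δ) {g : (V →ₗ[ℚ] V)ˣ} (hg : g ∈ transvectionGroup B Δ) {δ' : V}
    (hδ' : Relation.ReflTransGen (fun a b => a ∈ Δ ∧ b ∈ Δ ∧ B a b ≠ 0) δ₀ δ') :
    Relation.ReflTransGen (fun a b => a ∈ Δ ∧ b ∈ Δ ∧ B a b ≠ 0) δ₀ ((g : V →ₗ[ℚ] V) δ') := by
  unfold transvectionGroup at hg
  induction hg using Subgroup.closure_induction'' generalizing δ' with
  | mem u hu =>
      obtain ⟨δ, hδ, hu'⟩ := hu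
      have hmem : u ∈ transvectionGroup B Δ := Subgroup.subset_closure ⟨δ, hδ, hu'⟩
      refine localTubeSpan_reach_step B hB hδ₀ hδ hδ'
        (hΔ.stable u hmem δ' (localTubeSpan_reach_mem B hδ₀ hδ')) ?_ ?_
      · rw [hu', skewTransvection_apply, map_sub, map_smul, hB.self_eq_zero δ, smul_zero, sub_zero]
      · intro h0
        rw [hu', skewTransvection_apply, h0, zero_smul, sub_zero]
  | inv_mem u hu =>
      obtain ⟨δ, hδ, hu'⟩ := hu
      have hmem : u⁻¹ ∈ transvectionGroup B Δ :=
        Subgroup.inv_mem _ (Subgroup.subset_closure ⟨δ, hδ, hu'⟩)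
      refine localTubeSpan_reach_step B hB hδ₀ hδ hδ'
        (hΔ.stable _ hmem δ' (localTubeSpan_reach_mem B hδ₀ hδ')) ?_ ?_
      · rw [localTubeSpan_unit_inv_apply B hu' (hB.self_eq_zero δ), map_add, map_smul,
          hB.self_eq_zero δ, smul_zero, add_zero]
      · intro h0
        rw [localTubeSpan_unit_inv_apply B hu' (hB.self_eq_zero δ), h0, zero_smul, add_zero]
  | one =>
      rw [Units.val_one, Module.End.one_apply]
      exact hδ'
  | mul g g' _ _ ih ih' =>
      rw [Units.val_mul, Module.End.mul_apply]
      exact ih (ih' hδ')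

/-- **The non-orthogonality graph of a skew vanishing lattice is connected**: every `δ ∈ Δ` is
reachable from every `δ₀ ∈ Δ` through cycles of `Δ` with consecutive nonzero pairings (`Δ` is a
single `Γ_Δ`-orbit and the reachable set is `Γ_Δ`-stable).
[cite: Schnell2010, §7 Lemma 11 (proof)] -/
theorem localTubeSpan_reach_all (hB : B.IsAlt) {Δ : Set V} (hΔ : IsSkewVanishingLattice B Δ)
    {δ₀ δ : V} (hδ₀ : δ₀ ∈ Δ) (hδ : δ ∈ Δ) :
    Relation.ReflTransGen (fun a b => a ∈ Δ ∧ b ∈ Δ ∧ B a b ≠ 0) δ₀ δ := by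
  obtain ⟨g, hg, hgδ⟩ := hΔ.transitive δ₀ hδ₀ δ hδ
  rw [← hgδ]
  exact localTubeSpan_reach_stable B hB hΔ hδ₀ hg Relation.ReflTransGen.refl

end Reach

/-! ### The orbit of a finite-index subgroup spans -/

section OrbitSpan

/-- **Orbit span** (stub `stub_orbitSpan` of line `Sketch`, cycle 6).  For a skew vanishing lattice
`Δ` of an alternating, possibly degenerate, form `B` and a finite-index subgroup `H ≤ Γ_Δ`, the
`H`-orbit of any `δ₀ ∈ Δ` spans `V` (indeed `ℚ⟨H · δ₀⟩ = ℚΔ`): powers `T_δ^m ∈ H` give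
`δ ∈ ℚ⟨H · δ₀⟩` whenever some `w ∈ ℚ⟨H · δ₀⟩` has `B(w, δ) ≠ 0`, and this propagates along the
(connected) non-orthogonality graph of `Δ`. [cite: Schnell2010, §7 Lemma 11 (proof)] -/
theorem localTubeSpan_orbitSpan {V : Type} [AddCommGroup V] [Module ℚ V]
    (B : LinearMap.BilinForm ℚ V) (hB : B.IsAlt) (Δ : Set V)
    (hΔ : IsSkewVanishingLattice B Δ) (H : Subgroup (V →ₗ[ℚ] V)ˣ)
    (hH : H ≤ transvectionGroup B Δ)
    (hfi : (H.subgroupOf (transvectionGroup B Δ)).FiniteIndex) (δ₀ : V) (hδ₀ : δ₀ ∈ Δ) :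
    Submodule.span ℚ {x : V | ∃ h ∈ H, ((h : (V →ₗ[ℚ] V)ˣ) : V →ₗ[ℚ] V) δ₀ = x} = ⊤ := by
  set W : Submodule ℚ V :=
    Submodule.span ℚ {x : V | ∃ h ∈ H, ((h : (V →ₗ[ℚ] V)ˣ) : V →ₗ[ℚ] V) δ₀ = x} with hW
  -- `W` is `H`-stable
  have hWH : ∀ h ∈ H, ∀ w ∈ W, ((h : (V →ₗ[ℚ] V)ˣ) : V →ₗ[ℚ] V) w ∈ W := by
    intro h hh w hw
    have hle : W.map ((h : (V →ₗ[ℚ] V)ˣ) : V →ₗ[ℚ] V) ≤ W := by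
      rw [hW, Submodule.map_span_le]
      rintro _ ⟨h', hh', rfl⟩
      exact Submodule.subset_span ⟨h * h', H.mul_mem hh hh', by
        rw [Units.val_mul, Module.End.mul_apply]⟩
    exact hle (Submodule.mem_map_of_mem hw)
  have hδ₀W : δ₀ ∈ W :=
    Submodule.subset_span ⟨1, H.one_mem, by rw [Units.val_one, Module.End.one_apply]⟩
  -- every `T_δ`, `δ ∈ Δ`, has a positive power in `H`
  have hpow : ∀ δ ∈ Δ, ∃ u : (V →ₗ[ℚ] V)ˣ, (u : V →ₗ[ℚ] V) = skewTransvection B δ ∧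
      ∃ n : ℕ, 0 < n ∧ u ^ n ∈ H := by
    intro δ hδ
    have hu := unit_skewTransvection_mem_transvectionGroup B hδ (hB.self_eq_zero δ)
    obtain ⟨n, hn, -, hnH⟩ := Subgroup.exists_pow_mem_of_index_ne_zero
      (Subgroup.FiniteIndex.index_ne_zero (H := H.subgroupOf (transvectionGroup B Δ)))
      (⟨_, hu⟩ : transvectionGroup B Δ)
    rw [Subgroup.mem_subgroupOf, SubgroupClass.coe_pow] at hnH
    exact ⟨_, rfl, n, hn, hnH⟩
  -- a cycle not orthogonal to `W` lies in `W`
  have hstep : ∀ w ∈ W, ∀ δ ∈ Δ, B w δ ≠ 0 → δ ∈ W := by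
    intro w hw δ hδ hwδ
    obtain ⟨u, hu, n, hn, hnH⟩ := hpow δ hδ
    have h1 := hWH _ hnH w hw
    rw [localTubeSpan_unit_pow_apply B hu (hB.self_eq_zero δ)] at h1
    have h2 : ((n : ℚ) * B w δ) • δ ∈ W := by
      have := W.sub_mem hw h1
      rwa [sub_sub_cancel] at this
    exact (W.smul_mem_iff (mul_ne_zero (Nat.cast_ne_zero.2 hn.ne') hwδ)).1 h2
  -- hence every cycle reachable from `δ₀` lies in `W`, i.e. all of `Δ`
  have hreach : ∀ δ : V,
      Relation.ReflTransGen (fun a b => a ∈ Δ ∧ b ∈ Δ ∧ B a b ≠ 0) δ₀ δ → δ ∈ W := by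
    intro δ h
    induction h with
    | refl => exact hδ₀W
    | tail _ hbc ih => exact hstep _ ih _ hbc.2.1 hbc.2.2
  -- so `W = ℚΔ` (the orbit `H · δ₀` lies in `Δ` as `H ≤ Γ_Δ`), which is all of `V`
  have hWΔ : W = Submodule.span ℚ Δ := by
    refine le_antisymm (Submodule.span_mono ?_) (Submodule.span_le.2 fun δ hδ => ?_)
    · rintro _ ⟨h, hh, rfl⟩
      exact hΔ.stable h (hH hh) δ₀ hδ₀
    · exact hreach δ (localTubeSpan_reach_all B hB hΔ hδ₀ hδ)
  rw [hWΔ, hΔ.span_eq_top]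

end OrbitSpan

end Summit.HodgeConjecture.HodgeConjecture.Theorems

end
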